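import Summits.AtomisticToContinuum.Crystallization.Theorems.ChargedEnergyGapChartDialD

/-!
# `ChargedEnergyGap` · the CHART DIAL, part E: the SHELL MARGIN — decomp-a2c lens-3 g37 node «ShellMargin» (first rung of UPGRADE)

Beneath `UpgradeWitness θ R M R'` (part D §4, the residual of COLLAR; the line beneath `ChartedChargePricing θ` is
`FarFieldPricing θ R ∧ UpgradeWitness θ R M R' ⟹ ChartedChargePricing θ`, `chartedChargePricing_of_far_upgrade`).

§1 SHELL BOUNDS (proved): a shell `θ`-close (`ShellCloseTo`, η-matched) to a kissing pattern has norms `≤ 1 + θ` and pairwise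
   distances `≥ 1 − 2θ` (`shellCloseTo_bounds`, `chartedAt_bounds`).
§2 THE SHELL MARGIN (proved): `nn_shell_ge` — every point `q ≠ p` of the `6/5`-shell ball of a `θ`-charted site `p` (`θ ≤ 4/5`)
   has own scale `nn q ≥ (1/5 − θ)·nn p` (at the chart dial `θ = 3/20`: `nn q ≥ nn p / 20`, `nn_shell_ge_div_twenty`).  Proof: in the
   shell frame of `p` (`shellCoord`, an injection of the shell ball into `shellSet Q p`) the nearest neighbour of `q` is the centre
   (`≥ nn p`), another shell point (normalised distance `≥ 1 − 2θ`), or a point outside the ball (`> (6/5 − (1 + θ))·nn p`, triangle).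
§3 FIRST RUNG OF UPGRADE (proved): `nearGrossCmp_of_core_in_shell` — a gross charged core `y + g` inside the shell ball of a charted
   charged site `x` is a COMPARABLE witness, `NearGrossCmp θ R (1/5 − θ)⁻¹ Q (pt Q x)` for any `R ≥ 6/5` (translation invariance
   `Blocks.nearestDist_transl`).  What remains of UPGRADE is the case of cores OUTSIDE the `6/5`-ball (scale coherence along charted chains).
-/

noncomputable section

open Literature.MathematicalPhysics.StatisticalMechanics
open Literature.Geometry.DiscreteGeometry
open Summit.AtomisticToContinuum.Crystallization.Theses.PricedLinkCensus
open Summit.AtomisticToContinuum.Crystallization.Theorems.ChargedEnergyGapNegative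
namespace Summit.AtomisticToContinuum.Crystallization.Theorems.ChargedEnergyGapChartDial

/-! ## §1 Shell bounds -/

/-- A shell `θ`-close to a pattern on the unit sphere with pairwise distances `≥ 1` has norms `≤ 1 + θ` and
pairwise distances `≥ 1 − 2θ`. -/
theorem shellCloseTo_bounds {θ : ℝ} {T P : Finset E3} (hP1 : ∀ v ∈ P, ‖v‖ = 1)
    (hP2 : ∀ v ∈ P, ∀ w ∈ P, v ≠ w → 1 ≤ dist v w) (h : ShellCloseTo θ T P) :
    (∀ t ∈ T, ‖t‖ ≤ 1 + θ) ∧ (∀ t ∈ T, ∀ t' ∈ T, t ≠ t' → 1 - 2 * θ ≤ dist t t') := by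
  obtain ⟨A, e, he⟩ := h
  have himg : ∀ s : ↥(P.image A), ∃ v ∈ P, A v = (s : E3) := fun s => Finset.mem_image.1 s.2
  refine ⟨fun t ht => ?_, fun t ht t' ht' hne => ?_⟩
  · obtain ⟨v, hv, hv'⟩ := himg (e ⟨t, ht⟩)
    have h1 : ‖(e ⟨t, ht⟩ : E3)‖ = 1 := by rw [← hv', A.norm_map, hP1 v hv]
    have h2 : ‖t - (e ⟨t, ht⟩ : E3)‖ ≤ θ := by rw [← dist_eq_norm]; exact he ⟨t, ht⟩
    calc ‖t‖ = ‖(t - (e ⟨t, ht⟩ : E3)) + (e ⟨t, ht⟩ : E3)‖ := by rw [sub_add_cancel]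
      _ ≤ ‖t - (e ⟨t, ht⟩ : E3)‖ + ‖(e ⟨t, ht⟩ : E3)‖ := norm_add_le _ _
      _ ≤ θ + 1 := add_le_add h2 h1.le
      _ = 1 + θ := add_comm _ _
  · obtain ⟨v, hv, hv'⟩ := himg (e ⟨t, ht⟩)
    obtain ⟨w, hw, hw'⟩ := himg (e ⟨t', ht'⟩)
    have hne' : e ⟨t, ht⟩ ≠ e ⟨t', ht'⟩ := fun h => hne (by simpa using e.injective h)
    have hvw : v ≠ w := fun h => hne' (Subtype.ext (by rw [← hv', ← hw', h]))
    have hd : 1 ≤ dist (e ⟨t, ht⟩ : E3) (e ⟨t', ht'⟩ : E3) := by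
      rw [← hv', ← hw', A.isometry.dist_eq]; exact hP2 v hv w hw hvw
    have tri := dist_triangle4 (e ⟨t, ht⟩ : E3) t t' (e ⟨t', ht'⟩ : E3)
    rw [dist_comm (e ⟨t, ht⟩ : E3) t] at tri
    linarith [he ⟨t, ht⟩, he ⟨t', ht'⟩]

/-- The bounds for a `θ`-charted shell (FCC or HCP pattern). -/
theorem chartedAt_bounds {θ : ℝ} {Q : PeriodicConfiguration 3} {p : Q.points} (hp : ChartedAt θ Q p) :
    ∃ T : Finset E3, (↑T : Set E3) = shellSet Q p ∧
      (∀ t ∈ T, ‖t‖ ≤ 1 + θ) ∧ (∀ t ∈ T, ∀ t' ∈ T, t ≠ t' → 1 - 2 * θ ≤ dist t t') := by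
  obtain ⟨T, hT, h⟩ := hp
  refine ⟨T, hT, ?_⟩
  rcases h with h | h
  · exact shellCloseTo_bounds (fun v hv => norm_eq_one_of_mem_fccKissingPattern hv)
      (fun v hv w hw hvw => one_le_dist_of_mem_fccKissingPattern hv hw hvw) h
  · exact shellCloseTo_bounds (fun v hv => norm_eq_one_of_mem_hcpKissingPattern hv)
      (fun v hv w hw hvw => one_le_dist_of_mem_hcpKissingPattern hv hw hvw) h

/-! ## §2 The shell margin -/

section margin

variable (Q : PeriodicConfiguration 3)

/-- The normalised position of `q` in the shell frame of `p`. -/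
def shellCoord (p : Q.points) (q : E3) : E3 := (nn Q p)⁻¹ • (q - (p : E3))

/-- A point of the shell ball, normalised, lies in `shellSet`. -/
theorem shellCoord_mem {p q : Q.points} (hqp : q ≠ p) (hq : dist (p : E3) q ≤ 6 / 5 * nn Q p) :
    shellCoord Q p q ∈ shellSet Q p :=
  ⟨q, ⟨q.2, fun h => hqp (Subtype.ext h), hq⟩, rfl⟩

/-- `dist p q = nn(p) · ‖shellCoord p q‖`. -/
theorem dist_eq_nn_mul_norm_shellCoord (p : Q.points) (q : E3) :
    dist (p : E3) q = nn Q p * ‖shellCoord Q p q‖ := by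
  have hc : 0 < nn Q p := Blocks.nearestDist_pt_pos Q p
  rw [shellCoord, norm_smul, Real.norm_eq_abs, abs_of_pos (inv_pos.2 hc), ← mul_assoc,
    mul_inv_cancel₀ hc.ne', one_mul, dist_comm, dist_eq_norm]

/-- `dist q r = nn(p) · dist (shellCoord p q) (shellCoord p r)`. -/
theorem dist_eq_nn_mul_dist_shellCoord (p : Q.points) (q r : E3) :
    dist q r = nn Q p * dist (shellCoord Q p q) (shellCoord Q p r) := by
  have hc : 0 < nn Q p := Blocks.nearestDist_pt_pos Q p
  rw [shellCoord, shellCoord, dist_smul₀, Real.norm_eq_abs, abs_of_pos (inv_pos.2 hc), ← mul_assoc,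
    mul_inv_cancel₀ hc.ne', one_mul, dist_sub_right]

/-- `shellCoord p` is injective. -/
theorem shellCoord_injective (p : Q.points) : Function.Injective (shellCoord Q p) := by
  intro q r h
  have hc : 0 < nn Q p := Blocks.nearestDist_pt_pos Q p
  have := smul_right_injective E3 (inv_ne_zero hc.ne') h
  simpa using this

/-- **SHELL MARGIN** (energy-free, first rung of UPGRADE): every point of the `6/5`-shell ball of a `θ`-charted site
(`θ ≤ 4/5`) has own scale `≥ (1/5 − θ) · nn` — its nearest neighbour is the centre (`≥ nn`), another shell point (`≥ (1 − 2θ)·nn`,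
pattern separation) or outside the ball (`> (6/5 − (1 + θ))·nn`).  At `θ = 3/20`: `nn(q) ≥ nn(p)/20`. -/
theorem nn_shell_ge {θ : ℝ} (hθ1 : θ ≤ 4 / 5) {p q : Q.points} (hp : ChartedAt θ Q p)
    (hqp : q ≠ p) (hq : dist (p : E3) q ≤ 6 / 5 * nn Q p) : (1 / 5 - θ) * nn Q p ≤ nn Q q := by
  obtain ⟨T, hT, hB1, hB2⟩ := chartedAt_bounds hp
  have hc : 0 < nn Q p := Blocks.nearestDist_pt_pos Q p
  have hmem : ∀ r : Q.points, r ≠ p → dist (p : E3) r ≤ 6 / 5 * nn Q p → shellCoord Q p r ∈ T := by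
    intro r hrp hr
    rw [← Finset.mem_coe, hT]; exact shellCoord_mem Q hrp hr
  have hpq : dist (p : E3) q ≤ (1 + θ) * nn Q p := by
    rw [dist_eq_nn_mul_norm_shellCoord, mul_comm]
    exact mul_le_mul_of_nonneg_right (hB1 _ (hmem q hqp hq)) hc.le
  refine le_nearestDist ⟨p, hqp.symm⟩ fun r hr => ?_
  show (1 / 5 - θ) * nn Q p ≤ dist (q : E3) (r : E3)
  by_cases hrp : r = p
  · subst hrp
    have h1 : nn Q r ≤ dist (r : E3) q := nearestDist_le_dist (Subtype.val : Q.points → E3) hqp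
    rw [dist_comm]; nlinarith
  by_cases hrb : dist (p : E3) r ≤ 6 / 5 * nn Q p
  · have hne : shellCoord Q p q ≠ shellCoord Q p r := fun h =>
      hr (Subtype.ext (shellCoord_injective Q p h)).symm
    have h2 := hB2 _ (hmem q hqp hq) _ (hmem r hrp hrb) hne
    rw [dist_eq_nn_mul_dist_shellCoord Q p]
    nlinarith
  · push Not at hrb
    have tri := dist_triangle (p : E3) (q : E3) (r : E3)
    nlinarith

/-- At `θ = 3/20`: shell points of a charted site have own scale `≥ nn/20`. -/
theorem nn_shell_ge_div_twenty {p q : Q.points} (hp : ChartedAt (3 / 20) Q p) (hqp : q ≠ p)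
    (hq : dist (p : E3) q ≤ 6 / 5 * nn Q p) : nn Q p / 20 ≤ nn Q q := by
  have := nn_shell_ge Q (by norm_num) hp hqp hq
  linarith

/-! ## §3 First rung of UPGRADE: cores inside the shell ball -/

/-- **UPGRADE's first rung**: a defect core inside the `6/5`-shell ball of a `θ`-charted site (`0 ≤ θ < 1/5`) is a
COMPARABLE witness (`θ < 1/5`), with `M = (1/5 − θ)⁻¹` and any `R ≥ 6/5` — the «decorated isolated shell» family is no
counterexample to `UpgradeWitness`. -/
theorem nearGrossCmp_of_core_in_shell {θ R : ℝ} (hθ1 : θ < 1 / 5) (hR : 6 / 5 ≤ R)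
    {x y : Q.motif} {g : E3} (hg : g ∈ Q.lattice) (hC : Charged Q y) (hU : ¬ ChartedAt θ Q (pt Q y))
    (hx : ChartedAt θ Q (pt Q x)) (hd : dist (x : E3) ((y : E3) + g) ≤ 6 / 5 * nn Q (pt Q x)) :
    NearGrossCmp θ R (1 / 5 - θ)⁻¹ Q (pt Q x) := by
  have hc : 0 < nn Q (pt Q x) := Blocks.nearestDist_pt_pos Q _
  set q : Q.points := Blocks.transl Q hg (pt Q y) with hqdef
  have hqv : (q : E3) = (y : E3) + g := rfl
  have hnnq : nn Q q = nn Q (pt Q y) := Blocks.nearestDist_transl Q hg (pt Q y)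
  have hqx : q ≠ pt Q x := by
    intro h
    have hv : (y : E3) + g = (x : E3) := by simpa [hqv] using congrArg Subtype.val h
    have hxy : (x : E3) = (y : E3) :=
      Q.eq_of_sub_mem x.1 x.2 y.1 y.2 (by rw [show (x : E3) - y = g by rw [← hv]; abel]; exact hg)
    rw [show pt Q x = pt Q y from Subtype.ext hxy] at hx
    exact hU hx
  have hmargin := nn_shell_ge Q (by linarith) hx hqx (by rw [hqv]; exact hd)
  rw [hnnq] at hmargin
  have hk : 0 < 1 / 5 - θ := by linarith
  refine ⟨y, g, hg, hC, hU, hd.trans (mul_le_mul_of_nonneg_right hR hc.le), ?_⟩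
  exact (le_inv_mul_iff₀ hk).2 hmargin

end margin

end Summit.AtomisticToContinuum.Crystallization.Theorems.ChargedEnergyGapChartDial

end
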